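/-
HONEST FRAMING: certified error envelopes and provably optimal rounding/accumulation schemes for
low-precision formats under stated cost models; every table by two implementations; no hardware
or vendor claims.
-/
import Summits.Ventures.CertifiedArithmetic.LowPrec.OptTreeMixedWitness

/-!
# The demotion law (Theorem T8), part 1: recursive summation in a wide format, one final rounding

Cost model CM-B/demote (OPTIMA.md §B, Theorem T8).  A sum of nonnegative floating-point numbers of
the WIDE binary format `F(q, emin)` is accumulated recursively in that format (one rounding to
nearest per addition, any tie rule, gradual underflow) and the final value is rounded ONCE to the
NARROW format `F(p, emin)` (any nearest rounding).  Exact law for `n` summands: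

*  UPPER BOUND (`exact_le_demotion_sequential`): `s ≤ (1 + u_p + (n-1)·u_q) · fl_p(ŝ)`, i.e. the
   relative under-estimation `(s - fl_p ŝ)/s` never exceeds `1 - 1/(1 + u_p + (n-1) u_q)`; it holds
   for all `p, q ≥ 1` (no relation between the two precisions is needed) and every `n`.
*  ATTAINMENT (`demotion_sequential_attained`): for nearest maps that round the binade midpoints
   `2^e (1+u_p)` of `F_p` to `2^e` (`TiesEvenAtPow`, IEEE ties-to-even does) and the midpoints
   `2^e (1+u_p) + 2^(e-q)` of `F_q` down to `2^e (1+u_p)` (`TiesDownAtShift`; IEEE ties-to-even does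
   when `q ≥ p + 2`, the significand `2^(q-1) + 2^(q-1-p)` being even), the summands
   `x₁ = 2^e (1+u_p)`, `x₂ = ⋯ = x_n = 2^(e-q)` give `fl_p(ŝ) = 2^e` and `s = (1 + u_p + (n-1) u_q)·2^e`
   exactly; such nearest maps exist (`exists_roundNearest_tiesDownAtShift`).

So the worst case of "accumulate wide, demote once" for recursive summation is EXACTLY
`1 - 1/(1 + u_p + (n-1) u_q)` — the first-order folklore `u_p + (n-1) u_q` made exact, with the
cross term identified.  Ingredients: the half-ulp bound `|t - fl t| ≤ u·2^k` on the binade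
`[2^k, 2^(k+1))`, monotonicity consequences of nearest rounding, exactness below the underflow
threshold (powers of two are floats: `PTree.isFloat_two_zpow` of `OptTreeMixedWitness`), and the chain deficit lemma `s - ŝ ≤ (n-1)·u_q·2^K` whenever `ŝ < 2^(K+1)`.
-/

namespace Summit.Ventures.CertifiedArithmetic.LowPrec.Opt

open Literature.ComputerArithmetic.JeannerodRump2018

/-! ## Nearest rounding: monotonicity consequences and the half-ulp bound -/

/-- A float below `t` stays below `fl t` (else it would be a strictly better candidate). -/
theorem le_fl_of_isFloat_le {p : ℕ} {emin : ℤ} {fl : ℚ → ℚ} (hfl : IsRoundNearest p emin fl)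
    {t f : ℚ} (hf : IsFloat p emin f) (hft : f ≤ t) : f ≤ fl t := by
  by_contra h
  have h' := not_le.mp h
  have h1 := abs_sub_fl_le hfl t hf
  rw [abs_of_nonneg (by linarith : 0 ≤ t - fl t), abs_of_nonneg (by linarith : 0 ≤ t - f)] at h1
  linarith

/-- A float above `t` stays above `fl t`. -/
theorem fl_le_of_le_isFloat {p : ℕ} {emin : ℤ} {fl : ℚ → ℚ} (hfl : IsRoundNearest p emin fl)
    {t f : ℚ} (hf : IsFloat p emin f) (htf : t ≤ f) : fl t ≤ f := by
  by_contra h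
  have h' := not_le.mp h
  have h1 := abs_sub_fl_le hfl t hf
  rw [abs_of_nonpos (by linarith : t - fl t ≤ 0), abs_of_nonpos (by linarith : t - f ≤ 0)] at h1
  linarith

/-- HALF-ULP BOUND: on the binade `2^k ≤ t < 2^(k+1)` whose grid spacing `2^(k+1-p)` is at least
`2^emin`, every nearest rounding satisfies `|t - fl t| ≤ u·2^k` (`u = 2^-p`): `t` lies between two
consecutive grid points `m·2^(k+1-p) ≤ t ≤ (m+1)·2^(k+1-p)`, both floats. -/
theorem abs_sub_fl_le_half_ulp {p : ℕ} (hp : 1 ≤ p) {emin : ℤ} {fl : ℚ → ℚ}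
    (hfl : IsRoundNearest p emin fl) {t : ℚ} {k : ℤ} (hlow : (2 : ℚ) ^ k ≤ t)
    (hup : t < (2 : ℚ) ^ (k + 1)) (hke : emin + p ≤ k + 1) :
    |t - fl t| ≤ unitRoundoff p * (2 : ℚ) ^ k := by
  have h2 : (2 : ℚ) ≠ 0 := by norm_num
  set c : ℚ := (2 : ℚ) ^ (k + 1 - p) with hc
  have hcpos : 0 < c := zpow_pos (by norm_num) _
  have hg : (2 : ℚ) ^ k = (2 : ℚ) ^ ((p : ℤ) - 1) * c := by
    rw [hc, ← zpow_add₀ h2]; congr 1; ring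
  have hg2 : (2 : ℚ) ^ (k + 1) = (2 : ℚ) ^ (p : ℤ) * c := by
    rw [hc, ← zpow_add₀ h2]; congr 1; ring
  set m := ⌊t / c⌋ with hm
  have hm_le : (m : ℚ) ≤ t / c := Int.floor_le _
  have hm_lt : t / c < m + 1 := Int.lt_floor_add_one _
  have hm_ge : (2 ^ (p - 1) : ℤ) ≤ m := by
    rw [hm, Int.le_floor]; push_cast
    rw [le_div_iff₀ hcpos]
    have : ((2 : ℕ) : ℚ) ^ (p - 1) * c = (2 : ℚ) ^ k := by
      rw [hg, show ((p : ℤ) - 1) = ((p - 1 : ℕ) : ℤ) by omega, zpow_natCast]; push_cast; ring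
    push_cast at this; linarith
  have hm_lt' : m < (2 ^ p : ℤ) := by
    rw [hm, Int.floor_lt]; push_cast
    rw [div_lt_iff₀ hcpos]
    have : ((2 : ℕ) : ℚ) ^ p * c = (2 : ℚ) ^ (k + 1) := by rw [hg2, zpow_natCast]; push_cast; ring
    push_cast at this; linarith
  have hm0 : (0 : ℤ) ≤ m := le_trans (by positivity) hm_ge
  have hf1 : IsFloat p emin ((m : ℚ) * c) := by
    refine ⟨m, k + 1 - p, ?_, by omega, rfl⟩
    rw [abs_of_nonneg hm0]; exact hm_lt'
  have hf2 : IsFloat p emin (((m + 1 : ℤ) : ℚ) * c) := by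
    rcases lt_or_eq_of_le (Int.add_one_le_iff.mpr hm_lt') with hlt | heq
    · refine ⟨m + 1, k + 1 - p, ?_, by omega, rfl⟩
      rw [abs_of_nonneg (by omega)]; exact hlt
    · refine ⟨2 ^ (p - 1), k + 2 - p, ?_, by omega, ?_⟩
      · rw [abs_of_nonneg (by positivity)]
        exact_mod_cast Nat.pow_lt_pow_right (by norm_num) (by omega : p - 1 < p)
      · rw [heq]; push_cast
        rw [show (k + 2 - (p : ℤ)) = (k + 1 - p) + 1 by ring, zpow_add₀ h2, zpow_one, ← hc,
          show ((2 : ℚ) ^ p : ℚ) = 2 ^ (p - 1) * 2 by rw [← pow_succ]; congr 1; omega]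
        ring
  have e1 := abs_sub_fl_le hfl t hf1
  have e2 := abs_sub_fl_le hfl t hf2
  have hf1le : (m : ℚ) * c ≤ t := by rwa [le_div_iff₀ hcpos] at hm_le
  have hf2ge : t ≤ ((m + 1 : ℤ) : ℚ) * c := by
    push_cast; rw [div_lt_iff₀ hcpos] at hm_lt; linarith
  rw [abs_of_nonneg (by linarith : 0 ≤ t - m * c)] at e1
  rw [abs_of_nonpos (by linarith : t - ((m + 1 : ℤ) : ℚ) * c ≤ 0)] at e2
  push_cast at e2
  have hu : unitRoundoff p * (2 : ℚ) ^ k = c / 2 := by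
    unfold unitRoundoff
    rw [hc, zpow_sub₀ h2, zpow_add_one₀ h2, zpow_natCast]
    ring
  rw [hu]
  -- |t - fl t| ≤ min (t - m c, (m+1) c - t) ≤ c/2
  rcases le_or_gt (t - fl t) 0 with hneg | hpos
  · rw [abs_of_nonpos hneg] at e1 e2 ⊢; linarith
  · rw [abs_of_pos hpos] at e1 e2 ⊢; linarith

/-! ## Recursive (sequential) summation from an accumulator -/

/-- Recursive summation `((acc + y₁) + y₂) + ⋯` with one rounding `fl` per addition. -/
def chainEval (fl : ℚ → ℚ) (acc : ℚ) : List ℚ → ℚ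
  | [] => acc
  | y :: ys => chainEval fl (fl (acc + y)) ys

/-- `chainEval` unfolds one step. -/
@[simp] theorem chainEval_nil (fl : ℚ → ℚ) (acc : ℚ) : chainEval fl acc [] = acc := rfl

/-- `chainEval` unfolds one step. -/
@[simp] theorem chainEval_cons (fl : ℚ → ℚ) (acc y : ℚ) (ys : List ℚ) :
    chainEval fl acc (y :: ys) = chainEval fl (fl (acc + y)) ys := rfl

/-- The computed recursive sum is a float and dominates the (nonnegative float) accumulator it
started from: nearest rounding of `acc + y ≥ acc` cannot drop below the float `acc`. -/
theorem acc_le_chainEval {q : ℕ} {emin : ℤ} {fl : ℚ → ℚ} (hfl : IsRoundNearest q emin fl) :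
    ∀ (ys : List ℚ) (acc : ℚ), IsFloat q emin acc → (∀ y ∈ ys, IsFloat q emin y ∧ 0 ≤ y) →
      IsFloat q emin (chainEval fl acc ys) ∧ acc ≤ chainEval fl acc ys
  | [], acc, hacc, _ => ⟨by simpa using hacc, by simp⟩
  | y :: ys, acc, hacc, hys => by
      have hy := hys y (by simp)
      have hrest : ∀ z ∈ ys, IsFloat q emin z ∧ 0 ≤ z := fun z hz => hys z (by simp [hz])
      have ih := acc_le_chainEval hfl ys (fl (acc + y)) (hfl _).1 hrest
      have h1 : acc ≤ fl (acc + y) := le_fl_of_isFloat_le hfl hacc (by linarith [hy.2])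
      simp only [chainEval_cons]
      exact ⟨ih.1, le_trans h1 ih.2⟩

/-- EXACTNESS BELOW THE UNDERFLOW THRESHOLD: if the computed recursive sum of nonnegative floats is
`< 2^(emin+q)`, no rounding error occurred at all (every partial sum was a small multiple of
`2^emin`, hence a float). -/
theorem chainEval_eq_exact_of_small {q : ℕ} (hq : 1 ≤ q) {emin : ℤ} {fl : ℚ → ℚ}
    (hfl : IsRoundNearest q emin fl) :
    ∀ (ys : List ℚ) (acc : ℚ), IsFloat q emin acc → 0 ≤ acc → (∀ y ∈ ys, IsFloat q emin y ∧ 0 ≤ y) →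
      chainEval fl acc ys < (2 : ℚ) ^ (emin + q) → chainEval fl acc ys = acc + ys.sum
  | [], acc, _, _, _, _ => by simp
  | y :: ys, acc, hacc, hacc0, hys, hsmall => by
      have hy := hys y (by simp)
      have hrest : ∀ z ∈ ys, IsFloat q emin z ∧ 0 ≤ z := fun z hz => hys z (by simp [hz])
      simp only [chainEval_cons] at hsmall ⊢
      have hF : IsFloat q emin (fl (acc + y)) := (hfl _).1
      have hge := (acc_le_chainEval hfl ys (fl (acc + y)) hF hrest).2
      -- the first addition was exact
      have hlt : acc + y < (2 : ℚ) ^ (emin + q) := by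
        by_contra hc
        have h2 : (2 : ℚ) ^ (emin + q) ≤ fl (acc + y) :=
          le_fl_of_isFloat_le hfl (PTree.isFloat_two_zpow hq (by omega)) (not_lt.mp hc)
        linarith
      have hex : fl (acc + y) = acc + y :=
        fl_eq_self hfl (isFloat_add_of_small hacc hy.1 (by
          rw [abs_of_nonneg (by linarith [hy.2])]; exact_mod_cast hlt))
      rw [hex] at hsmall hge ⊢
      have ih := chainEval_eq_exact_of_small hq hfl ys (acc + y) (hex ▸ hF) (by linarith [hy.2])
        hrest hsmall
      rw [ih, List.sum_cons]; ring

/-- CHAIN DEFICIT LEMMA: if the computed recursive sum `ŝ` of nonnegative floats of `F(q, emin)`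
(from a nonnegative float accumulator) is `< 2^(K+1)`, then `acc + Σ yᵢ - ŝ ≤ |ys| · u_q · 2^K`:
the partial sums increase towards `ŝ`, so every addition happens in a binade `≤ K` and loses at
most half an ulp `u_q 2^K` (nothing below the underflow threshold). -/
theorem chain_deficit_le {q : ℕ} (hq : 1 ≤ q) {emin : ℤ} {fl : ℚ → ℚ}
    (hfl : IsRoundNearest q emin fl) :
    ∀ (ys : List ℚ) (acc : ℚ), IsFloat q emin acc → 0 ≤ acc → (∀ y ∈ ys, IsFloat q emin y ∧ 0 ≤ y) →
      ∀ K : ℤ, chainEval fl acc ys < (2 : ℚ) ^ (K + 1) →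
        acc + ys.sum - chainEval fl acc ys ≤ (ys.length : ℚ) * (unitRoundoff q * (2 : ℚ) ^ K)
  | [], acc, _, _, _, K, _ => by simp
  | y :: ys, acc, hacc, hacc0, hys, K, hK => by
      have hy := hys y (by simp)
      have hrest : ∀ z ∈ ys, IsFloat q emin z ∧ 0 ≤ z := fun z hz => hys z (by simp [hz])
      simp only [chainEval_cons] at hK ⊢
      set a' := fl (acc + y) with ha'
      have hF : IsFloat q emin a' := (hfl _).1
      have hge := (acc_le_chainEval hfl ys a' hF hrest).2
      have ih := chain_deficit_le hq hfl ys a' hF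
        (le_trans hacc0 (le_fl_of_isFloat_le hfl hacc (by linarith [hy.2]))) hrest K hK
      have hupos : 0 ≤ unitRoundoff q * (2 : ℚ) ^ K :=
        mul_nonneg (unitRoundoff_nonneg q) (zpow_nonneg (by norm_num) _)
      -- the first addition loses at most u_q 2^K
      have hstep : acc + y - a' ≤ unitRoundoff q * (2 : ℚ) ^ K := by
        by_cases hsm : acc + y < (2 : ℚ) ^ (emin + q)
        · have hex : a' = acc + y := fl_eq_self hfl (isFloat_add_of_small hacc hy.1 (by
            rw [abs_of_nonneg (by linarith [hy.2])]; exact_mod_cast hsm))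
          rw [hex, sub_self]; exact hupos
        · have hbig : (2 : ℚ) ^ (emin + q) ≤ acc + y := not_lt.mp hsm
          have hpos : 0 < acc + y := lt_of_lt_of_le (zpow_pos (by norm_num) _) hbig
          -- binade of acc + y
          set k := Int.log 2 (acc + y) with hk
          have hlow : ((2 : ℕ) : ℚ) ^ k ≤ acc + y := Int.zpow_log_le_self (by norm_num) hpos
          have hup : acc + y < ((2 : ℕ) : ℚ) ^ (k + 1) := Int.lt_zpow_succ_log_self (by norm_num) _
          push_cast at hlow hup
          have hk_ge : emin + q ≤ k + 1 := by
            by_contra hlt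
            have : (2 : ℚ) ^ (k + 1) ≤ (2 : ℚ) ^ (emin + (q : ℤ)) :=
              zpow_le_zpow_right₀ (by norm_num) (by omega)
            linarith
          -- a' ≤ ŝ < 2^(K+1) forces acc + y < 2^(K+1), so k ≤ K
          have hKe : emin ≤ K + 1 := by
            by_contra hlt
            have h1 : (2 : ℚ) ^ (K + 1) ≤ (2 : ℚ) ^ (emin + (q : ℤ) - 1) :=
              zpow_le_zpow_right₀ (by norm_num) (by omega)
            have h2 : (2 : ℚ) ^ (emin + (q : ℤ) - 1) ≤ (2 : ℚ) ^ (emin + (q : ℤ)) :=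
              zpow_le_zpow_right₀ (by norm_num) (by omega)
            have h3 : (2 : ℚ) ^ (emin + (q : ℤ)) ≤ a' :=
              le_fl_of_isFloat_le hfl (PTree.isFloat_two_zpow hq (by omega)) hbig
            linarith
          have hlt2 : acc + y < (2 : ℚ) ^ (K + 1) := by
            by_contra hc
            have := le_fl_of_isFloat_le hfl (PTree.isFloat_two_zpow hq hKe) (not_lt.mp hc)
            linarith
          have hkK : k ≤ K := by
            by_contra hc
            have : (2 : ℚ) ^ (K + 1) ≤ (2 : ℚ) ^ k := zpow_le_zpow_right₀ (by norm_num) (by omega)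
            linarith
          have herr := abs_sub_fl_le_half_ulp hq hfl hlow hup hk_ge
          have hmono : (2 : ℚ) ^ k ≤ (2 : ℚ) ^ K := zpow_le_zpow_right₀ (by norm_num) hkK
          calc acc + y - a' ≤ |acc + y - a'| := le_abs_self _
            _ ≤ unitRoundoff q * (2 : ℚ) ^ k := herr
            _ ≤ unitRoundoff q * (2 : ℚ) ^ K := mul_le_mul_of_nonneg_left hmono (unitRoundoff_nonneg q)
      rw [List.sum_cons, List.length_cons]; push_cast
      linarith

/-! ## The demotion law for recursive summation -/

/-- A float of `F(q, emin)` below `2^(emin + p)` is a float of `F(p, emin)` (it is `N·2^emin` with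
`0 ≤ N < 2^p`). -/
theorem isFloat_narrow_of_small {p q : ℕ} {emin : ℤ} {c : ℚ} (hc : IsFloat q emin c) (hc0 : 0 ≤ c)
    (hsmall : c < (2 : ℚ) ^ (emin + p)) : IsFloat p emin c := by
  obtain ⟨N, hN⟩ := hc.exists_int_mul_zpow_emin
  have h2 : (0 : ℚ) < (2 : ℚ) ^ emin := zpow_pos (by norm_num) _
  rw [hN]
  refine isFloat_of_int_mul N emin ?_ le_rfl
  rw [hN, zpow_add₀ (by norm_num : (2 : ℚ) ≠ 0), zpow_natCast, mul_comm] at hsmall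
  have hN0 : (0 : ℚ) ≤ N := by
    by_contra h
    have : (N : ℚ) * (2 : ℚ) ^ emin < 0 := mul_neg_of_neg_of_pos (not_le.mp h) h2
    linarith
  have hlt : (N : ℚ) < 2 ^ p := lt_of_mul_lt_mul_left hsmall h2.le
  have hlt' : N < (2 : ℤ) ^ p := by exact_mod_cast hlt
  have hN0' : 0 ≤ N := by exact_mod_cast hN0
  rw [abs_of_nonneg hN0']; exact hlt'

/-- THE DEMOTION LAW, UPPER BOUND (Theorem T8(a)): nonnegative floats `x, y₁, …, y_m` of the wide
format `F(q, emin)` summed recursively with any nearest rounding `fl_q`, the result rounded once by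
any nearest rounding `fl_p` into `F(p, emin)`:
`x + Σ yᵢ ≤ (1 + u_p + m·u_q) · fl_p(ŝ)`  (`m = n - 1` additions; all `p, q ≥ 1`). -/
theorem exact_le_demotion_sequential {p q : ℕ} (hp : 1 ≤ p) (hq : 1 ≤ q) {emin : ℤ}
    {flq flp : ℚ → ℚ} (hflq : IsRoundNearest q emin flq) (hflp : IsRoundNearest p emin flp)
    (x : ℚ) (ys : List ℚ) (hx : IsFloat q emin x) (hx0 : 0 ≤ x)
    (hys : ∀ y ∈ ys, IsFloat q emin y ∧ 0 ≤ y) :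
    x + ys.sum ≤ (1 + unitRoundoff p + (ys.length : ℚ) * unitRoundoff q) * flp (chainEval flq x ys) := by
  set c := chainEval flq x ys with hc
  have hcF : IsFloat q emin c := (acc_le_chainEval hflq ys x hx hys).1
  have hxc : x ≤ c := (acc_le_chainEval hflq ys x hx hys).2
  have hc0 : 0 ≤ c := le_trans hx0 hxc
  have hup0 : 0 ≤ unitRoundoff p := unitRoundoff_nonneg p
  have huq0 : 0 ≤ unitRoundoff q := unitRoundoff_nonneg q
  have hlen0 : (0 : ℚ) ≤ (ys.length : ℚ) := by positivity
  by_cases hsmallp : c < (2 : ℚ) ^ (emin + p)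
  · -- no demotion error: c ∈ F_p
    have hr : flp c = c := fl_eq_self hflp (isFloat_narrow_of_small hcF hc0 hsmallp)
    rw [hr]
    rcases eq_or_lt_of_le hc0 with hzero | hpos
    · -- c = 0: everything was exact (c < 2^(emin+q)), so the sum is 0
      have hex := chainEval_eq_exact_of_small hq hflq ys x hx hx0 hys (by
        have h0 : c < (2 : ℚ) ^ (emin + (q : ℤ)) := by rw [← hzero]; exact zpow_pos (by norm_num) _
        simpa [hc] using h0)
      replace hex : c = x + ys.sum := by simpa [hc] using hex
      rw [← hex, ← hzero]; simp
    · set K := Int.log 2 c with hK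
      have hlow : ((2 : ℕ) : ℚ) ^ K ≤ c := Int.zpow_log_le_self (by norm_num) hpos
      have hupK : c < ((2 : ℕ) : ℚ) ^ (K + 1) := Int.lt_zpow_succ_log_self (by norm_num) _
      push_cast at hlow hupK
      have hdef : x + ys.sum - c ≤ (ys.length : ℚ) * (unitRoundoff q * (2 : ℚ) ^ K) := by
        simpa [hc] using chain_deficit_le hq hflq ys x hx hx0 hys K hupK
      have h1 : (ys.length : ℚ) * (unitRoundoff q * (2 : ℚ) ^ K)
          ≤ (ys.length : ℚ) * (unitRoundoff q * c) :=
        mul_le_mul_of_nonneg_left (mul_le_mul_of_nonneg_left hlow huq0) hlen0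
      nlinarith [mul_nonneg hup0 hpos.le]
  · -- demotion in the normal range of F_p
    have hbig : (2 : ℚ) ^ (emin + p) ≤ c := not_lt.mp hsmallp
    have hpos : 0 < c := lt_of_lt_of_le (zpow_pos (by norm_num) _) hbig
    set K := Int.log 2 c with hK
    have hlow : ((2 : ℕ) : ℚ) ^ K ≤ c := Int.zpow_log_le_self (by norm_num) hpos
    have hupK : c < ((2 : ℕ) : ℚ) ^ (K + 1) := Int.lt_zpow_succ_log_self (by norm_num) _
    push_cast at hlow hupK
    have hKe : emin + p ≤ K + 1 := by
      by_contra hlt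
      have : (2 : ℚ) ^ (K + 1) ≤ (2 : ℚ) ^ (emin + (p : ℤ)) :=
        zpow_le_zpow_right₀ (by norm_num) (by omega)
      linarith
    have hdef : x + ys.sum - c ≤ (ys.length : ℚ) * (unitRoundoff q * (2 : ℚ) ^ K) := by
      simpa [hc] using chain_deficit_le hq hflq ys x hx hx0 hys K hupK
    -- |c - r| ≤ u_p 2^K and 2^K ≤ r
    have herr := abs_sub_fl_le_half_ulp hp hflp hlow hupK hKe
    have hr_ge : (2 : ℚ) ^ K ≤ flp c :=
      le_fl_of_isFloat_le hflp (PTree.isFloat_two_zpow hp (by omega)) hlow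
    have hcr : c - flp c ≤ unitRoundoff p * (2 : ℚ) ^ K := le_trans (le_abs_self _) herr
    have h1 : (ys.length : ℚ) * (unitRoundoff q * (2 : ℚ) ^ K)
        ≤ (ys.length : ℚ) * (unitRoundoff q * flp c) :=
      mul_le_mul_of_nonneg_left (mul_le_mul_of_nonneg_left hr_ge huq0) hlen0
    have h2 : unitRoundoff p * (2 : ℚ) ^ K ≤ unitRoundoff p * flp c :=
      mul_le_mul_of_nonneg_left hr_ge hup0
    nlinarith

/-- Relative form of the demotion law: `(s - fl_p ŝ) ≤ (1 - 1/(1 + u_p + m u_q)) · s`. -/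
theorem demotion_sequential_relative {p q : ℕ} (hp : 1 ≤ p) (hq : 1 ≤ q) {emin : ℤ}
    {flq flp : ℚ → ℚ} (hflq : IsRoundNearest q emin flq) (hflp : IsRoundNearest p emin flp)
    (x : ℚ) (ys : List ℚ) (hx : IsFloat q emin x) (hx0 : 0 ≤ x)
    (hys : ∀ y ∈ ys, IsFloat q emin y ∧ 0 ≤ y) :
    (x + ys.sum) - flp (chainEval flq x ys)
      ≤ (1 - 1 / (1 + unitRoundoff p + (ys.length : ℚ) * unitRoundoff q)) * (x + ys.sum) := by
  have h := exact_le_demotion_sequential hp hq hflq hflp x ys hx hx0 hys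
  have hQ : 0 < 1 + unitRoundoff p + (ys.length : ℚ) * unitRoundoff q := by
    have := unitRoundoff_nonneg p; have := unitRoundoff_nonneg q; positivity
  rw [sub_mul, one_mul, div_mul_eq_mul_div, one_mul, sub_le_sub_iff_left, div_le_iff₀ hQ]
  linarith

end Summit.Ventures.CertifiedArithmetic.LowPrec.Opt
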